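import Summits.ValiantsHypothesis.ValiantsHypothesis.Theorems.SymPencilEquivariantSdcNotQPPermRetractFrobenius
import HarnessLib

/-!
# ValiantsHypothesis / SymPencil — crux `EquivariantSdcNotQP` (stmt-ValiantsHypothesis-17792), line
# `birth_EquivariantSdcNotQP`, stub `stub_permify`: bookkeeping for the reduction of the residue (D)
# to two classical statements about the alternating groups (`…PermEmbeddingOfYoungBounds.lean`)

Group-theoretic and arithmetic preliminaries (helper of the item,
`--supports stmt-ValiantsHypothesis-17792 --as helper`; 0 definitions, 0 named facts):
* `card_range_le_of_pow_eq_one` — a character `f` with `f^M = 1` has image of size `≤ M`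
  (roots of unity in `ℂ`);
* `index_ker_le_card_mul` — a representation `ρ : G →* GL_k(ℂ)` scalar with `M`-th roots of unity on
  the kernel of `φ : G →* P` has `[G : ker ρ] ≤ |P| · M`;
* `ker_sup_ker_eq_top_of_perfect`, `index_ker_le_of_sup_eq_top` — over a PERFECT quotient
  `ψ : E ↠ Q`, a linear character `θ` is determined on `ker ψ`: `ker θ ⊔ ker ψ = E`, so
  `[E : ker θ] ≤ M` if `θ^M = 1` on `ker ψ`;
* `commutator_alternating_prod_eq_top` (`𝔄_n × 𝔄_n` is perfect, `n ≥ 5`, from Mathlib's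
  `commutator_alternatingGroup_eq_top`), `index_alternating_prod_le` (`[𝔖_n² : 𝔄_n²] ≤ 4`);
* budget arithmetic `exp_large`, `exp_small`, `budget_mono`, `budget_large`, `budget_small`
  (`|𝔖_n × 𝔖_n| · M` and `4 · 2^{(log₂ k + log₂ n + c)^c} · M` against `2^{(log₂ M + log₂ n + d)^d}`).

Honest framing: bookkeeping only; `stub_permify`, the crux `SymPencil.EquivariantSdcNotQP` and
`VP ≠ VNP` remain OPEN and nothing here is progress on them.
-/

noncomputable section

set_option linter.dupNamespace false

namespace Summit.ValiantsHypothesis.ValiantsHypothesis.Theorems.SymPencilEquivariantSdcNotQP.YoungBounds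

open Matrix

/-! ## Bookkeeping: characters of finite order, indices of kernels -/

/-- A finite-order character: if `f(x)^M = 1` for all `x` (`M ≠ 0`) then the image of `f` has at
most `M` elements (it lies in the `M`-th roots of unity of `ℂ`). [folklore] -/
theorem card_range_le_of_pow_eq_one {H : Type*} [Group H] (f : H →* ℂˣ) (M : ℕ) (hM : M ≠ 0)
    (h : ∀ x, f x ^ M = 1) : Nat.card f.range ≤ M := by
  haveI : NeZero M := ⟨hM⟩
  have hle : f.range ≤ rootsOfUnity M ℂ := by
    rintro u ⟨x, rfl⟩
    exact (mem_rootsOfUnity M (f x)).mpr (h x)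
  calc Nat.card f.range ≤ Nat.card (rootsOfUnity M ℂ) :=
        Nat.card_le_card_of_injective _ (Subgroup.inclusion_injective hle)
    _ = M := Complex.card_rootsOfUnity M

/-- The scalar attached to a scalar matrix: if `A = c • 1` then `c = A i i`. [folklore] -/
theorem scalar_eq_apply {k : ℕ} (i : Fin k) {A : Matrix (Fin k) (Fin k) ℂ} {c : ℂ}
    (h : A = c • (1 : Matrix (Fin k) (Fin k) ℂ)) : c = A i i := by
  rw [h, Matrix.smul_apply, Matrix.one_apply_eq, smul_eq_mul, mul_one]

/-- **Index of the kernel of a representation that is scalar, with `M`-th roots of unity, on the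
kernel of `φ : G →* P`:** `[G : ker ρ] ≤ |P| · M`. [folklore] -/
theorem index_ker_le_card_mul {G P : Type*} [Group G] [Group P] [Finite G] [Finite P]
    {k : ℕ} (hk : 1 ≤ k) (M : ℕ) (hM : M ≠ 0)
    (φ : G →* P) (ρ : G →* GL (Fin k) ℂ)
    (hker : ∀ g : G, φ g = 1 → ∃ c : ℂ, c ^ M = 1 ∧
      (ρ g : Matrix (Fin k) (Fin k) ℂ) = c • (1 : Matrix (Fin k) (Fin k) ℂ)) :
    ρ.ker.index ≤ Nat.card P * M := by
  classical
  set i₀ : Fin k := ⟨0, hk⟩ with hi₀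
  have hsc : ∀ g : φ.ker, ∃ c : ℂ, c ^ M = 1 ∧
      (ρ g : Matrix (Fin k) (Fin k) ℂ) = c • (1 : Matrix (Fin k) (Fin k) ℂ) :=
    fun g => hker g g.2
  have hne : ∀ g : φ.ker, (ρ g : Matrix (Fin k) (Fin k) ℂ) i₀ i₀ ≠ 0 := by
    intro g
    obtain ⟨c, hcM, hc⟩ := hsc g
    rw [← scalar_eq_apply i₀ hc]
    intro h0
    rw [h0, zero_pow hM] at hcM
    exact zero_ne_one hcM
  have hform : ∀ g : φ.ker, (ρ g : Matrix (Fin k) (Fin k) ℂ) =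
      (ρ g : Matrix (Fin k) (Fin k) ℂ) i₀ i₀ • (1 : Matrix (Fin k) (Fin k) ℂ) := by
    intro g
    obtain ⟨c, -, hc⟩ := hsc g
    rw [← scalar_eq_apply i₀ hc]; exact hc
  -- the character on `ker φ`
  let χ : φ.ker →* ℂˣ :=
    { toFun := fun g => Units.mk0 ((ρ g : Matrix (Fin k) (Fin k) ℂ) i₀ i₀) (hne g)
      map_one' := by
        apply Units.ext
        simp only [Units.val_mk0, OneMemClass.coe_one, map_one, Units.val_one, Matrix.one_apply_eq]
      map_mul' := fun a b => by
        apply Units.ext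
        simp only [Units.val_mk0, Units.val_mul]
        rw [Subgroup.coe_mul, map_mul, Units.val_mul]
        conv_lhs => rw [hform a, hform b]
        simp only [Matrix.smul_mul, Matrix.one_mul, Matrix.smul_apply, Matrix.one_apply_eq,
          smul_eq_mul, mul_one] }
  have hχ : ∀ g : φ.ker, ((χ g : ℂˣ) : ℂ) = (ρ g : Matrix (Fin k) (Fin k) ℂ) i₀ i₀ := fun g => rfl
  have hχM : ∀ g : φ.ker, χ g ^ M = 1 := by
    intro g
    apply Units.ext
    obtain ⟨c, hcM, hc⟩ := hsc g
    rw [Units.val_pow_eq_pow_val, hχ, ← scalar_eq_apply i₀ hc, hcM, Units.val_one]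
  -- `ker (ρ ∘ incl) = ker χ`
  have hkk : (ρ.comp φ.ker.subtype).ker = χ.ker := by
    ext g
    rw [MonoidHom.mem_ker, MonoidHom.mem_ker, MonoidHom.comp_apply, Subgroup.coe_subtype]
    constructor
    · intro h1
      apply Units.ext
      rw [hχ, h1, Units.val_one, Units.val_one, Matrix.one_apply_eq]
    · intro h1
      apply Units.ext
      rw [hform g, ← hχ, h1, Units.val_one, one_smul, Units.val_one]
  -- index bookkeeping
  have h1 : ρ.ker.index ≤ (ρ.ker ⊓ φ.ker).index :=
    Nat.le_of_dvd (Nat.pos_of_ne_zero Subgroup.index_ne_zero_of_finite)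
      (Subgroup.index_dvd_of_le inf_le_left)
  have h2 : (ρ.ker ⊓ φ.ker).index = ρ.ker.relIndex φ.ker * φ.ker.index := by
    rw [← Subgroup.relIndex_mul_index (inf_le_right : ρ.ker ⊓ φ.ker ≤ φ.ker),
      Subgroup.inf_relIndex_right]
  have h3 : ρ.ker.relIndex φ.ker = Nat.card χ.range := by
    rw [Subgroup.relIndex, Subgroup.subgroupOf, MonoidHom.comap_ker, hkk, Subgroup.index_ker]
  have h4 : φ.ker.index ≤ Nat.card P := by
    rw [Subgroup.index_ker]
    exact Nat.card_le_card_of_injective _ φ.range.subtype_injective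
  calc ρ.ker.index ≤ ρ.ker.relIndex φ.ker * φ.ker.index := h1.trans h2.le
    _ ≤ M * Nat.card P := Nat.mul_le_mul (h3 ▸ card_range_le_of_pow_eq_one χ M hM hχM) h4
    _ = Nat.card P * M := Nat.mul_comm _ _

/-- **Perfect quotient:** if `ψ : E ↠ Q` with `Q` perfect, every character `θ : E →* ℂˣ` satisfies
`ker θ ⊔ ker ψ = ⊤` (`θ` kills commutators, and commutators together with `ker ψ` generate `E`).
[folklore] -/
theorem ker_sup_ker_eq_top_of_perfect {E Q : Type*} [Group E] [Group Q]
    (hQ : commutator Q = ⊤) (ψ : E →* Q) (hψ : Function.Surjective ψ) (θ : E →* ℂˣ) :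
    θ.ker ⊔ ψ.ker = ⊤ := by
  have h1 : (commutator E).map ψ = ⊤ := by
    rw [commutator, Subgroup.map_commutator, ← MonoidHom.range_eq_map,
      MonoidHom.range_eq_top.mpr hψ, ← commutator, hQ]
  have h2 : commutator E ⊔ ψ.ker = ⊤ := by
    rw [← Subgroup.comap_map_eq, h1, Subgroup.comap_top]
  rw [eq_top_iff, ← h2]
  exact sup_le_sup_right (Abelianization.commutator_subset_ker θ) _

/-- If `ker θ ⊔ ker ψ = ⊤` and `θ` has order dividing `M` on `ker ψ`, then `[E : ker θ] ≤ M`.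
[folklore] -/
theorem index_ker_le_of_sup_eq_top {E Q : Type*} [Group E] [Group Q]
    (ψ : E →* Q) (θ : E →* ℂˣ) (hsup : θ.ker ⊔ ψ.ker = ⊤) (M : ℕ) (hM : M ≠ 0)
    (hθ : ∀ g : E, ψ g = 1 → θ g ^ M = 1) : θ.ker.index ≤ M := by
  have h1 : θ.ker.index = θ.ker.relIndex ψ.ker := by
    rw [← Subgroup.relIndex_sup_left, hsup, Subgroup.relIndex_top_right]
  have h2 : θ.ker.relIndex ψ.ker = Nat.card (θ.comp ψ.ker.subtype).range := by
    rw [Subgroup.relIndex, Subgroup.subgroupOf, MonoidHom.comap_ker, Subgroup.index_ker]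
  rw [h1, h2]
  exact card_range_le_of_pow_eq_one _ M hM fun g => hθ g g.2

/-- `𝔄_n × 𝔄_n` is perfect for `n ≥ 5` (Mathlib: `𝔄_n` is perfect; commutators of products).
[folklore] -/
theorem commutator_alternating_prod_eq_top (n : ℕ) (hn : 5 ≤ n) :
    commutator (↥(alternatingGroup (Fin n)) × ↥(alternatingGroup (Fin n))) = ⊤ := by
  have hA : commutator ↥(alternatingGroup (Fin n)) = ⊤ :=
    commutator_alternatingGroup_eq_top (by rw [Nat.card_eq_fintype_card, Fintype.card_fin]; exact hn)
  rw [commutator] at hA ⊢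
  rw [← Subgroup.top_prod_top, Subgroup.commutator_prod_prod, hA, Subgroup.top_prod_top]

/-- `[𝔖_n × 𝔖_n : 𝔄_n × 𝔄_n] ≤ 4`. [folklore] -/
theorem index_alternating_prod_le (n : ℕ) :
    ((alternatingGroup (Fin n)).prod (alternatingGroup (Fin n))).index ≤ 4 := by
  have h2 : (alternatingGroup (Fin n)).index ≤ 2 := by
    rw [alternatingGroup, Subgroup.index_ker]
    calc Nat.card (Equiv.Perm.sign (α := Fin n)).range ≤ Nat.card ℤˣ :=
          Nat.card_le_card_of_injective _ (Subgroup.subtype_injective _)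
      _ = 2 := by rw [Nat.card_eq_fintype_card, Fintype.card_units_int]
  rw [Subgroup.index_prod]
  calc (alternatingGroup (Fin n)).index * (alternatingGroup (Fin n)).index ≤ 2 * 2 :=
        Nat.mul_le_mul h2 h2
    _ = 4 := by norm_num

/-! ## Budget arithmetic -/

/-- Large regime exponent: `(L+1)(2a(A+1)+1) ≤ (L+A+(2a+3))^{2a+3}`. [folklore] -/
theorem exp_large (a L A : ℕ) :
    (L + 1) * (2 * a * (A + 1) + 1) ≤ (L + A + (2 * a + 3)) ^ (2 * a + 3) := by
  set x : ℕ := L + A + (2 * a + 3) with hx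
  have h1 : (L + 1) * (2 * a * (A + 1) + 1) ≤ (L + 1) * ((A + 1) * (2 * a + 3)) :=
    Nat.mul_le_mul_left _ (by nlinarith)
  have h2 : (L + 1) * ((A + 1) * (2 * a + 3)) ≤ x * (x * x) :=
    Nat.mul_le_mul (by omega) (Nat.mul_le_mul (by omega) (by omega))
  have h3 : x * (x * x) = x ^ 3 := by ring
  have h4 : x ^ 3 ≤ x ^ (2 * a + 3) := Nat.pow_le_pow_right (by omega) (by omega)
  exact h1.trans (h2.trans (h3.le.trans h4))

/-- Small regime exponent: `L + 3 + (L+A+c)^c ≤ (L+A+(c+3))^{c+3}`. [folklore] -/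
theorem exp_small (c L A : ℕ) :
    L + 3 + (L + A + c) ^ c ≤ (L + A + (c + 3)) ^ (c + 3) := by
  set x : ℕ := L + A + c with hx
  have hx3 : L + A + (c + 3) = x + 3 := by omega
  have hLx : L ≤ x := by omega
  have hcube : 2 * (x + 3) ≤ (x + 3) ^ 3 := by
    calc 2 * (x + 3) ≤ (x + 3) * (x + 3) := Nat.mul_le_mul_right _ (by omega)
      _ ≤ (x + 3) * (x + 3) * (x + 3) := Nat.le_mul_of_pos_right _ (by omega)
      _ = (x + 3) ^ 3 := by ring
  rw [hx3, pow_add]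
  rcases Nat.eq_zero_or_pos c with rfl | hc
  · rw [pow_zero, pow_zero, one_mul]
    omega
  · have hP1 : x ^ c ≤ (x + 3) ^ c := Nat.pow_le_pow_left (by omega) c
    have hP2 : x + 3 ≤ (x + 3) ^ c := by
      calc x + 3 = (x + 3) ^ 1 := (pow_one _).symm
        _ ≤ (x + 3) ^ c := Nat.pow_le_pow_right (by omega) hc
    calc L + 3 + x ^ c ≤ (x + 3) ^ c + (x + 3) ^ c := by omega
      _ ≤ (x + 3) ^ c * (x + 3) + (x + 3) ^ c * (x + 3) := by nlinarith
      _ = (x + 3) ^ c * (2 * (x + 3)) := by ring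
      _ ≤ (x + 3) ^ c * (x + 3) ^ 3 := Nat.mul_le_mul_left _ hcube

/-- Monotonicity of the budget in the exponent parameter. [folklore] -/
theorem budget_mono (L A d d' : ℕ) (h : d ≤ d') (hd : 1 ≤ d) :
    2 ^ ((L + A + d) ^ d) ≤ 2 ^ ((L + A + d') ^ d') := by
  refine Nat.pow_le_pow_right (by norm_num) ?_
  calc (L + A + d) ^ d ≤ (L + A + d') ^ d := Nat.pow_le_pow_left (by omega) d
    _ ≤ (L + A + d') ^ d' := Nat.pow_le_pow_right (by omega) h

/-- Large regime: `|𝔖_n × 𝔖_n| · M ≤ 2^{(log₂ M + log₂ n + (2a+3))^{2a+3}}` when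
`n ≤ a (log₂ M + 1)`. [folklore] -/
theorem budget_large (a n M : ℕ) (hn : n ≤ a * (Nat.log 2 M + 1)) :
    Nat.card (Equiv.Perm (Fin n) × Equiv.Perm (Fin n)) * M ≤
      2 ^ ((Nat.log 2 M + Nat.log 2 n + (2 * a + 3)) ^ (2 * a + 3)) := by
  set L := Nat.log 2 M with hL
  set A := Nat.log 2 n with hA
  have hM : M ≤ 2 ^ (L + 1) := (Nat.lt_pow_succ_log_self one_lt_two M).le
  have hn2 : n ≤ 2 ^ (A + 1) := (Nat.lt_pow_succ_log_self one_lt_two n).le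
  have hfact : Nat.factorial n ≤ 2 ^ (a * (L + 1) * (A + 1)) := by
    calc Nat.factorial n ≤ n ^ n := Nat.factorial_le_pow n
      _ ≤ (2 ^ (A + 1)) ^ n := Nat.pow_le_pow_left hn2 n
      _ = 2 ^ (n * (A + 1)) := by rw [← pow_mul, mul_comm]
      _ ≤ 2 ^ (a * (L + 1) * (A + 1)) :=
          Nat.pow_le_pow_right (by norm_num) (Nat.mul_le_mul_right _ hn)
  have hcard : Nat.card (Equiv.Perm (Fin n) × Equiv.Perm (Fin n)) = (Nat.factorial n) ^ 2 := by
    rw [Nat.card_prod, Nat.card_perm, Nat.card_eq_fintype_card, Fintype.card_fin, sq]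
  rw [hcard]
  calc (Nat.factorial n) ^ 2 * M ≤ (2 ^ (a * (L + 1) * (A + 1))) ^ 2 * 2 ^ (L + 1) :=
        Nat.mul_le_mul (Nat.pow_le_pow_left hfact 2) hM
    _ = 2 ^ ((L + 1) * (2 * a * (A + 1) + 1)) := by rw [← pow_mul, ← pow_add]; ring_nf
    _ ≤ 2 ^ ((L + A + (2 * a + 3)) ^ (2 * a + 3)) :=
        Nat.pow_le_pow_right (by norm_num) (exp_large a L A)

/-- Small regime: `4 · 2^{(log₂ k + log₂ n + c)^c} · M ≤ 2^{(log₂ M + log₂ n + (c+3))^{c+3}}` when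
`k ≤ M`. [folklore] -/
theorem budget_small (c n k M : ℕ) (hkM : k ≤ M) :
    4 * 2 ^ ((Nat.log 2 k + Nat.log 2 n + c) ^ c) * M ≤
      2 ^ ((Nat.log 2 M + Nat.log 2 n + (c + 3)) ^ (c + 3)) := by
  set L := Nat.log 2 M with hL
  set A := Nat.log 2 n with hA
  have hM : M ≤ 2 ^ (L + 1) := (Nat.lt_pow_succ_log_self one_lt_two M).le
  have hk : Nat.log 2 k ≤ L := Nat.log_mono_right hkM
  calc 4 * 2 ^ ((Nat.log 2 k + A + c) ^ c) * M
      ≤ 2 ^ 2 * 2 ^ ((L + A + c) ^ c) * 2 ^ (L + 1) := by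
        refine Nat.mul_le_mul (Nat.mul_le_mul (by norm_num) ?_) hM
        exact Nat.pow_le_pow_right (by norm_num) (Nat.pow_le_pow_left (by omega) c)
    _ = 2 ^ (L + 3 + (L + A + c) ^ c) := by rw [← pow_add, ← pow_add]; ring_nf
    _ ≤ 2 ^ ((L + A + (c + 3)) ^ (c + 3)) := Nat.pow_le_pow_right (by norm_num) (exp_small c L A)

end Summit.ValiantsHypothesis.ValiantsHypothesis.Theorems.SymPencilEquivariantSdcNotQP.YoungBounds

end
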